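import Mathlib
import HarnessLib
import Literature.Probability.MarkovChains.TotalVariation

/-!
# A chain looked at after an independent random time: `‖P_x{X_{T+T'} = ·} − π‖ ≤ ‖P_x{X_T = ·} − π‖` and `‖P{X_W = ·} − P{X_V = ·}‖ ≤ ‖P{W = ·} − P{V = ·}‖` (Levin–Peres–Wilmer Exercises 24.1, 24.3)

HONEST FRAMING: exact (Metropolis-corrected) sampling algorithms for lattice gauge theory; figures
of merit are autocorrelation/cost numbers at stated couplings and volumes; no continuum-physics claim.

Source: D. A. Levin, Y. Peres (with E. L. Wilmer), *Markov Chains and Mixing Times*, 2nd ed., AMS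
2017 [LevinPeres2017], Chapter 24 Exercises 24.1 and 24.3 (p. 346) — the two total-variation facts
about a chain observed at an independent random time that drive §24.1–24.2 (the geometric mixing
time `t_G`, Exercise 24.2, Proposition 24.4).  Everything is PROVED (finite sums; 0 named facts; no
definition is introduced).

Conventions of `TotalVariation.lean` (finite `X`, ROW kernel `P`, `lawAt P μ k = μPᵏ`, `tvDist`).
DECLARED SUBSTITUTION (statement): a random time `T` independent of the chain enters only through
its law; for `T` with finitely supported law `w` on a finite set `s ⊂ ℕ` of times the law of `X_T`
under `P_μ` IS `Σ_{k∈s} w(k)·μPᵏ` (`P_μ{X_T = y} = Σ_k P{T = k} P_μ{X_k = y}` by independence), and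
this finite mixture is what the statements below are about.
The book's generality — `ℕ`-valued `T` with possibly infinite support — is the section "General
(summable) laws" below: the law of `X_T` is the series `Σ_k w(k)·μPᵏ` for a summable weight sequence
`w` (`LevinPeres2017_exercise_24_3_tsum`, `LevinPeres2017_exercise_24_1_tsum`).

* `tvDist_lawAt_lawAt_le` — `‖μPᵏ − νPᵏ‖_TV ≤ ‖μ − ν‖_TV` (Exercise 4.2 iterated)
  [cite: LevinPeres2017, Exercise 4.2 (p. 57)];
* `LevinPeres2017_exercise_24_3` — **EXERCISE 24.3**: for `W`, `V` independent of the chain (laws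
  `w`, `v` on the times `s`), `‖P_μ{X_W = ·} − P_μ{X_V = ·}‖_TV ≤ ‖P{W = ·} − P{V = ·}‖_TV =
  ½ Σ_k |w(k) − v(k)|` (any start `μ` that is a probability vector) [cite: LevinPeres2017,
  Exercise 24.3];
* `LevinPeres2017_exercise_24_1` — **EXERCISE 24.1**: for `T`, `T'` independent, independent of the
  chain with stationary `π`, `‖P_x{X_{T+T'} = ·} − π‖_TV ≤ ‖P_x{X_T = ·} − π‖_TV`; typed with
  `ν = P_x{X_T = ·}` (any vector) and the law `w'` of `T'`: `‖Σ_k w'(k)·νPᵏ − π‖_TV ≤ ‖ν − π‖_TV`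
  (by the Markov property `P_x{X_{T+T'} = ·} = Σ_k P{T' = k}·(P_x{X_T = ·})Pᵏ`), and the two-time
  form `LevinPeres2017_exercise_24_1_sum` with `lawAt_add` [cite: LevinPeres2017, Exercise 24.1];
* `sum_abs_stepLaw_le` / `sum_abs_lawAt_le` / `abs_lawAt_le` (`‖μPᵏ‖₁ ≤ ‖μ‖₁`, the `ℓ¹`-contraction
  behind the summability of `Σ_k w(k)·μPᵏ`), `summable_mul_lawAt`, and the GENERAL FORMS
  `LevinPeres2017_exercise_24_3_tsum` (**Exercise 24.3 for `ℕ`-valued `W`, `V` with summable laws**: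
  `‖Σ_k w(k)μPᵏ − Σ_k v(k)μPᵏ‖_TV ≤ ½Σ_k |w(k) − v(k)|`) and `LevinPeres2017_exercise_24_1_tsum`
  (**Exercise 24.1 for an `ℕ`-valued `T'` with law `w'`, `Σ_k w'(k) = 1`**:
  `‖Σ_k w'(k)·νPᵏ − π‖_TV ≤ ‖ν − π‖_TV`) [cite: LevinPeres2017, Exercises 24.1, 24.3 (p. 346)].
-/

namespace Literature.Probability.MarkovChains

open Finset

variable {X : Type*} [Fintype X]

/-- **`‖μPᵏ − νPᵏ‖_TV ≤ ‖μ − ν‖_TV`** (row-stochastic `P`; Exercise 4.2 iterated `k` times).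
[cite: LevinPeres2017, Exercise 4.2 (p. 57)] -/
theorem tvDist_lawAt_lawAt_le {P : X → X → ℝ} (hP : IsRowStochastic P) (μ ν : X → ℝ) (k : ℕ) :
    tvDist (lawAt P μ k) (lawAt P ν k) ≤ tvDist μ ν := by
  induction k with
  | zero => simp [lawAt_zero]
  | succ k ih =>
    rw [lawAt_succ, lawAt_succ]
    exact (tvDist_stepLaw_le hP _ _).trans ih

/-- **EXERCISE 24.3 (Levin–Peres–Wilmer).**  Let `W`, `V` be random times independent of the chain,
with laws `w`, `v` carried by the finite set of times `s`.  Then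
`‖P_μ{X_W = ·} − P_μ{X_V = ·}‖_TV ≤ ‖P{W = ·} − P{V = ·}‖_TV`, i.e.
`‖Σ_{k∈s} w(k) μPᵏ − Σ_{k∈s} v(k) μPᵏ‖_TV ≤ ½ Σ_{k∈s} |w(k) − v(k)|`
(`P` row-stochastic, `μ` a probability vector). [cite: LevinPeres2017, Exercise 24.3] -/
theorem LevinPeres2017_exercise_24_3 {P : X → X → ℝ} (hP : IsRowStochastic P) {μ : X → ℝ}
    (hμ0 : ∀ x, 0 ≤ μ x) (hμ1 : ∑ x, μ x = 1) (s : Finset ℕ) (w v : ℕ → ℝ) :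
    tvDist (fun y => ∑ k ∈ s, w k * lawAt P μ k y) (fun y => ∑ k ∈ s, v k * lawAt P μ k y) ≤
      1 / 2 * ∑ k ∈ s, |w k - v k| := by
  unfold tvDist
  refine mul_le_mul_of_nonneg_left ?_ (by norm_num)
  calc ∑ y, |∑ k ∈ s, w k * lawAt P μ k y - ∑ k ∈ s, v k * lawAt P μ k y|
      = ∑ y, |∑ k ∈ s, (w k - v k) * lawAt P μ k y| := by
        refine sum_congr rfl fun y _ => ?_
        rw [← sum_sub_distrib]
        exact congrArg _ (sum_congr rfl fun k _ => by ring)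
    _ ≤ ∑ y, ∑ k ∈ s, |w k - v k| * lawAt P μ k y := by
        refine sum_le_sum fun y _ => (abs_sum_le_sum_abs _ _).trans (le_of_eq ?_)
        exact sum_congr rfl fun k _ => by
          rw [abs_mul, abs_of_nonneg (lawAt_nonneg hP hμ0 k y)]
    _ = ∑ k ∈ s, |w k - v k| := by
        rw [sum_comm]
        exact sum_congr rfl fun k _ => by rw [← mul_sum, sum_lawAt hP μ k, hμ1, mul_one]

/-- **EXERCISE 24.1 (Levin–Peres–Wilmer).**  If `T`, `T'` are independent random times, independent
of a chain with stationary distribution `π`, then `‖P_x{X_{T+T'} = ·} − π‖_TV ≤ ‖P_x{X_T = ·} − π‖_TV`.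
Typed through the Markov property `P_x{X_{T+T'} = ·} = Σ_k P{T' = k}·(νPᵏ)` with `ν = P_x{X_T = ·}`:
for every vector `ν` and every law `w'` (nonnegative, total mass one) of `T'` on the times `s`,
`‖Σ_{k∈s} w'(k)·νPᵏ − π‖_TV ≤ ‖ν − π‖_TV` — "running the chain for an independent further time can
only bring it closer to `π`" (`πPᵏ = π` and Exercise 4.2). [cite: LevinPeres2017, Exercise 24.1] -/
theorem LevinPeres2017_exercise_24_1 {P : X → X → ℝ} (hP : IsRowStochastic P) {π : X → ℝ}
    (hπ : IsStationary π P) (ν : X → ℝ) (s : Finset ℕ) {w' : ℕ → ℝ} (hw0 : ∀ k, 0 ≤ w' k)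
    (hw1 : ∑ k ∈ s, w' k = 1) :
    tvDist (fun y => ∑ k ∈ s, w' k * lawAt P ν k y) π ≤ tvDist ν π := by
  -- `π = Σ_k w'(k) πPᵏ`, so the difference is the mixture of `νPᵏ − πPᵏ`
  have hπk : ∀ k, lawAt P π k = π := fun k => lawAt_eq_self_of_isStationary hπ k
  have hdiff : ∀ y, ∑ k ∈ s, w' k * lawAt P ν k y - π y =
      ∑ k ∈ s, w' k * (lawAt P ν k y - lawAt P π k y) := by
    intro y
    have : π y = ∑ k ∈ s, w' k * lawAt P π k y := by
      simp_rw [hπk]; rw [← sum_mul, hw1, one_mul]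
    rw [this, ← sum_sub_distrib]
    exact sum_congr rfl fun k _ => by ring
  unfold tvDist
  refine mul_le_mul_of_nonneg_left ?_ (by norm_num)
  calc ∑ y, |∑ k ∈ s, w' k * lawAt P ν k y - π y|
      = ∑ y, |∑ k ∈ s, w' k * (lawAt P ν k y - lawAt P π k y)| :=
        sum_congr rfl fun y _ => by rw [hdiff y]
    _ ≤ ∑ y, ∑ k ∈ s, w' k * |lawAt P ν k y - lawAt P π k y| := by
        refine sum_le_sum fun y _ => (abs_sum_le_sum_abs _ _).trans (le_of_eq ?_)
        exact sum_congr rfl fun k _ => by rw [abs_mul, abs_of_nonneg (hw0 k)]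
    _ = ∑ k ∈ s, w' k * ∑ y, |lawAt P ν k y - lawAt P π k y| := by
        rw [sum_comm]; exact sum_congr rfl fun k _ => by rw [mul_sum]
    _ ≤ ∑ k ∈ s, w' k * ∑ y, |ν y - π y| := by
        refine sum_le_sum fun k _ => mul_le_mul_of_nonneg_left ?_ (hw0 k)
        have h := tvDist_lawAt_lawAt_le hP ν π k
        unfold tvDist at h
        linarith
    _ = ∑ y, |ν y - π y| := by rw [← sum_mul, hw1, one_mul]

/-- Exercise 24.1 with both times explicit: for laws `w` of `T` on `s` and `w'` of `T'` on `s'`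
(nonnegative, `Σ w' = 1`) and a start `μ`,
`‖Σ_{j∈s} Σ_{k∈s'} w(j)w'(k)·μP^{j+k} − π‖_TV ≤ ‖Σ_{j∈s} w(j)·μPʲ − π‖_TV`
(`P_μ{X_{T+T'} = y} = Σ_{j,k} P{T=j}P{T'=k} P_μ{X_{j+k} = y}`). [cite: LevinPeres2017, Exercise 24.1] -/
theorem LevinPeres2017_exercise_24_1_sum {P : X → X → ℝ} (hP : IsRowStochastic P) {π : X → ℝ}
    (hπ : IsStationary π P) (μ : X → ℝ) (s s' : Finset ℕ) (w : ℕ → ℝ) {w' : ℕ → ℝ}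
    (hw0 : ∀ k, 0 ≤ w' k) (hw1 : ∑ k ∈ s', w' k = 1) :
    tvDist (fun y => ∑ j ∈ s, ∑ k ∈ s', w j * w' k * lawAt P μ (j + k) y) π ≤
      tvDist (fun y => ∑ j ∈ s, w j * lawAt P μ j y) π := by
  set ν : X → ℝ := fun y => ∑ j ∈ s, w j * lawAt P μ j y with hν
  -- linearity of `η ↦ ηPᵏ` in `η`: `νPᵏ = Σ_j w(j) μP^{j+k}`
  have hlin : ∀ k y, lawAt P ν k y = ∑ j ∈ s, w j * lawAt P μ (j + k) y := by
    intro k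
    induction k with
    | zero => intro y; simp [hν, lawAt_zero]
    | succ k ih =>
      intro y
      rw [lawAt_succ]
      show ∑ x, lawAt P ν k x * P x y = _
      simp_rw [ih, sum_mul, mul_assoc]
      rw [sum_comm]
      refine sum_congr rfl fun j _ => ?_
      rw [← mul_sum, ← add_assoc, lawAt_succ]
      rfl
  have key : (fun y => ∑ j ∈ s, ∑ k ∈ s', w j * w' k * lawAt P μ (j + k) y) =
      fun y => ∑ k ∈ s', w' k * lawAt P ν k y := by
    funext y
    rw [sum_comm]
    refine sum_congr rfl fun k _ => ?_
    rw [hlin k y, mul_sum]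
    exact sum_congr rfl fun j _ => by ring
  rw [key]
  exact LevinPeres2017_exercise_24_1 hP hπ ν s' hw0 hw1

/-! ## General (summable) laws: `ℕ`-valued random times with infinite support -/

/-- **`ℓ¹`-contraction of one step: `Σ_y |(μP)(y)| ≤ Σ_x |μ(x)|`** for a row-stochastic `P` and any
(signed) vector `μ`. [cite: LevinPeres2017, Exercise 4.2 (p. 57) (the computation
`‖μP − νP‖_TV ≤ ‖μ − ν‖_TV`, here for a single signed vector)] -/
theorem sum_abs_stepLaw_le {P : X → X → ℝ} (hP : IsRowStochastic P) (μ : X → ℝ) :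
    ∑ y, |stepLaw P μ y| ≤ ∑ x, |μ x| := by
  calc ∑ y, |stepLaw P μ y| = ∑ y, |∑ x, μ x * P x y| := rfl
    _ ≤ ∑ y, ∑ x, |μ x| * P x y := by
        refine sum_le_sum fun y _ => (abs_sum_le_sum_abs _ _).trans (le_of_eq ?_)
        exact sum_congr rfl fun x _ => by rw [abs_mul, abs_of_nonneg (hP.1 x y)]
    _ = ∑ x, |μ x| := by
        rw [sum_comm]
        exact sum_congr rfl fun x _ => by rw [← mul_sum, hP.2 x, mul_one]

/-- `‖μPᵏ‖₁ ≤ ‖μ‖₁`. [cite: LevinPeres2017, Exercise 4.2 (p. 57), iterated] -/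
theorem sum_abs_lawAt_le {P : X → X → ℝ} (hP : IsRowStochastic P) (μ : X → ℝ) (k : ℕ) :
    ∑ y, |lawAt P μ k y| ≤ ∑ x, |μ x| := by
  induction k with
  | zero => simp [lawAt_zero]
  | succ k ih => rw [lawAt_succ]; exact (sum_abs_stepLaw_le hP _).trans ih

/-- `|(μPᵏ)(y)| ≤ ‖μ‖₁` — the uniform bound that makes `Σ_k w(k)(μPᵏ)(y)` converge for summable
`w`. [cite: LevinPeres2017, Exercise 4.2 (p. 57), iterated] -/
theorem abs_lawAt_le {P : X → X → ℝ} (hP : IsRowStochastic P) (μ : X → ℝ) (k : ℕ) (y : X) :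
    |lawAt P μ k y| ≤ ∑ x, |μ x| :=
  (single_le_sum (f := fun z => |lawAt P μ k z|) (fun _ _ => abs_nonneg _) (mem_univ y)).trans
    (sum_abs_lawAt_le hP μ k)

/-- For a summable weight sequence `w` (the law of an `ℕ`-valued random time, possibly of infinite
support) the series `Σ_k w(k)(μPᵏ)(y)` defining `P_μ{X_T = y}` converges (absolutely).
[cite: LevinPeres2017, Exercises 24.1, 24.3 (p. 346) (random times "with values in `ℕ`")] -/
theorem summable_mul_lawAt {P : X → X → ℝ} (hP : IsRowStochastic P) (μ : X → ℝ) {w : ℕ → ℝ}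
    (hw : Summable w) (y : X) : Summable fun k => w k * lawAt P μ k y := by
  refine Summable.of_norm_bounded (hw.abs.mul_right (∑ x, |μ x|)) fun k => ?_
  rw [Real.norm_eq_abs, abs_mul]
  exact mul_le_mul_of_nonneg_left (abs_lawAt_le hP μ k y) (abs_nonneg _)

/-- **EXERCISE 24.3 (Levin–Peres–Wilmer), general form.**  Let `W`, `V` be `ℕ`-valued random times
independent of the chain, with (summable) laws `w`, `v`.  Then
`‖P_μ{X_W = ·} − P_μ{X_V = ·}‖_TV ≤ ‖P{W = ·} − P{V = ·}‖_TV`, i.e.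
`‖Σ_k w(k) μPᵏ − Σ_k v(k) μPᵏ‖_TV ≤ ½ Σ_k |w(k) − v(k)|` (`P` row-stochastic, `μ` a probability vector).
[cite: LevinPeres2017, Exercise 24.3] -/
theorem LevinPeres2017_exercise_24_3_tsum {P : X → X → ℝ} (hP : IsRowStochastic P) {μ : X → ℝ}
    (hμ0 : ∀ x, 0 ≤ μ x) (hμ1 : ∑ x, μ x = 1) {w v : ℕ → ℝ} (hw : Summable w) (hv : Summable v) :
    tvDist (fun y => ∑' k, w k * lawAt P μ k y) (fun y => ∑' k, v k * lawAt P μ k y) ≤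
      1 / 2 * ∑' k, |w k - v k| := by
  have hwv : Summable fun k => w k - v k := hw.sub hv
  -- summability of the termwise absolute values `|w k − v k|·(μPᵏ)(y)`
  have habs : ∀ y, Summable fun k => |w k - v k| * lawAt P μ k y := fun y =>
    summable_mul_lawAt hP μ hwv.abs y
  unfold tvDist
  refine mul_le_mul_of_nonneg_left ?_ (by norm_num)
  calc ∑ y, |∑' k, w k * lawAt P μ k y - ∑' k, v k * lawAt P μ k y|
      = ∑ y, |∑' k, (w k - v k) * lawAt P μ k y| := by
        refine sum_congr rfl fun y _ => ?_
        rw [← (summable_mul_lawAt hP μ hw y).tsum_sub (summable_mul_lawAt hP μ hv y)]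
        exact congrArg _ (tsum_congr fun k => by ring)
    _ ≤ ∑ y, ∑' k, |w k - v k| * lawAt P μ k y := by
        refine sum_le_sum fun y _ => ?_
        have hn : Summable fun k => ‖(w k - v k) * lawAt P μ k y‖ :=
          (habs y).congr fun k => by
            rw [Real.norm_eq_abs, abs_mul, abs_of_nonneg (lawAt_nonneg hP hμ0 k y)]
        have h := norm_tsum_le_tsum_norm hn
        rw [Real.norm_eq_abs] at h
        refine h.trans (le_of_eq (tsum_congr fun k => ?_))
        rw [Real.norm_eq_abs, abs_mul, abs_of_nonneg (lawAt_nonneg hP hμ0 k y)]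
    _ = ∑' k, ∑ y, |w k - v k| * lawAt P μ k y :=
        (Summable.tsum_finsetSum fun y _ => habs y).symm
    _ = ∑' k, |w k - v k| := by
        refine tsum_congr fun k => ?_
        rw [← mul_sum, sum_lawAt hP μ k, hμ1, mul_one]

/-- **EXERCISE 24.1 (Levin–Peres–Wilmer), general form.**  If `T'` is an `ℕ`-valued random time with
law `w'` (`w' ≥ 0`, `Σ_k w'(k) = 1`), independent of `T` and of the chain with stationary `π`, then
`‖P_x{X_{T+T'} = ·} − π‖_TV ≤ ‖P_x{X_T = ·} − π‖_TV`; with `ν = P_x{X_T = ·}` (any vector):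
`‖Σ_k w'(k)·νPᵏ − π‖_TV ≤ ‖ν − π‖_TV`. [cite: LevinPeres2017, Exercise 24.1] -/
theorem LevinPeres2017_exercise_24_1_tsum {P : X → X → ℝ} (hP : IsRowStochastic P) {π : X → ℝ}
    (hπ : IsStationary π P) (ν : X → ℝ) {w' : ℕ → ℝ} (hw0 : ∀ k, 0 ≤ w' k) (hw : Summable w')
    (hw1 : ∑' k, w' k = 1) :
    tvDist (fun y => ∑' k, w' k * lawAt P ν k y) π ≤ tvDist ν π := by
  have hπk : ∀ k, lawAt P π k = π := fun k => lawAt_eq_self_of_isStationary hπ k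
  set C : ℝ := ∑ y, |ν y - π y| with hC
  -- summability bookkeeping
  have hsν : ∀ y, Summable fun k => w' k * lawAt P ν k y := fun y => summable_mul_lawAt hP ν hw y
  have hsπ : ∀ y, Summable fun k => w' k * lawAt P π k y := fun y => summable_mul_lawAt hP π hw y
  have hbd : ∀ k y, |lawAt P ν k y - lawAt P π k y| ≤ C := by
    intro k y
    have h := tvDist_lawAt_lawAt_le hP ν π k
    unfold tvDist at h
    have h' : ∑ z, |lawAt P ν k z - lawAt P π k z| ≤ C := by linarith
    exact (single_le_sum (f := fun z => |lawAt P ν k z - lawAt P π k z|)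
      (fun _ _ => abs_nonneg _) (mem_univ y)).trans h'
  have hsd : ∀ y, Summable fun k => w' k * |lawAt P ν k y - lawAt P π k y| := fun y =>
    (hw.mul_right C).of_nonneg_of_le (fun k => mul_nonneg (hw0 k) (abs_nonneg _))
      fun k => mul_le_mul_of_nonneg_left (hbd k y) (hw0 k)
  have hsC : Summable fun k => w' k * ∑ y, |lawAt P ν k y - lawAt P π k y| :=
    (hw.mul_right C).of_nonneg_of_le
      (fun k => mul_nonneg (hw0 k) (sum_nonneg fun _ _ => abs_nonneg _)) fun k =>
      mul_le_mul_of_nonneg_left (by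
        have h := tvDist_lawAt_lawAt_le hP ν π k
        unfold tvDist at h
        linarith) (hw0 k)
  -- `π = Σ_k w'(k) πPᵏ`
  have hπy : ∀ y, π y = ∑' k, w' k * lawAt P π k y := fun y => by
    simp_rw [hπk]
    rw [tsum_mul_right, hw1, one_mul]
  unfold tvDist
  refine mul_le_mul_of_nonneg_left ?_ (by norm_num)
  calc ∑ y, |∑' k, w' k * lawAt P ν k y - π y|
      = ∑ y, |∑' k, w' k * (lawAt P ν k y - lawAt P π k y)| := by
        refine sum_congr rfl fun y _ => ?_
        rw [hπy y, ← (hsν y).tsum_sub (hsπ y)]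
        exact congrArg _ (tsum_congr fun k => by ring)
    _ ≤ ∑ y, ∑' k, w' k * |lawAt P ν k y - lawAt P π k y| := by
        refine sum_le_sum fun y _ => ?_
        have hn : Summable fun k => ‖w' k * (lawAt P ν k y - lawAt P π k y)‖ :=
          (hsd y).congr fun k => by rw [Real.norm_eq_abs, abs_mul, abs_of_nonneg (hw0 k)]
        have h := norm_tsum_le_tsum_norm hn
        rw [Real.norm_eq_abs] at h
        refine h.trans (le_of_eq (tsum_congr fun k => ?_))
        rw [Real.norm_eq_abs, abs_mul, abs_of_nonneg (hw0 k)]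
    _ = ∑' k, ∑ y, w' k * |lawAt P ν k y - lawAt P π k y| :=
        (Summable.tsum_finsetSum fun y _ => hsd y).symm
    _ = ∑' k, w' k * ∑ y, |lawAt P ν k y - lawAt P π k y| :=
        tsum_congr fun k => by rw [mul_sum]
    _ ≤ ∑' k, w' k * C :=
        hsC.tsum_le_tsum (fun k => mul_le_mul_of_nonneg_left (by
          have h := tvDist_lawAt_lawAt_le hP ν π k
          unfold tvDist at h
          linarith) (hw0 k)) (hw.mul_right C)
    _ = C := by rw [tsum_mul_right, hw1, one_mul]

end Literature.Probability.MarkovChains
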